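import Summits.QuantumFields.BalabanUV.Beta.FP.CoarseFPExponential
import Summits.QuantumFields.BalabanUV.Beta.FP.SecondVarPolarisation

/-!
# `BalabanUV.Beta.FP.CoarseFPDefect` — road «FP» for binder row D1, ROUTE T (Q-FP-20-1's «no» branch, priced): **THE COARSE CHART's FADDEEV–POPOV 2-JET
# IN CLOSED FORM** — for comb-local jets the second variation along the comb forest is the SUM OF ITS SITE TERMS; for tip-type coarse jets with weights
# `u v` on the top comb it is `σ⁻² · Σ_{x tip-oriented} (σ·v(b_x) − u(b_x)²)` — the square law of `FP/CoarseFPExponential` is the termwise-zero case, and a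
# `D̄₂` that violates it leaves EXACTLY this sum as the coarse Faddeev–Popov defect

WHAT.  §1 **`secondVar_combRowsT_jets_eq_sum`** (generic comb `ρ N M`, ANY comb-local `D₀ D₁ D₂` with non-zero diagonal comb entries of `D₀`):
`secondVar (T·D₀↾) (T·D₁↾) (T·D₂↾) = Σ_x (D₂(b_x,x)∕D₀(b_x,x) − (D₁(b_x,x)∕D₀(b_x,x))²)`, `T = combRowsT ρ N M`, `b_x = combBondT x` — the OWNER's
`ForestTriangularJets.secondVar_forestTriangular_jets` (blockwise) + `secondVar_unique` (1×1 blocks) composed with leaf-06 g16's `combRowsT_mul_forestTriangular`;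
the sibling of `CombSliceJetLetters.secondVar_combRowsT_jets_eq_zero` with the per-site square law REMOVED.  §2 **`secondVar_combRowsT_tipJets_eq_sum`**:
at `D₀ := tgrad M` and the tip-type jets `D_{f₁} D_{f₂}` (ANY weights): `= Σ_x [tipOf x = x]·(f₂(b_x) − f₁(b_x)²)` — base-oriented comb bonds contribute
nothing, tip-oriented ones their square-law defect.  §3 at the torus call's coarse slice (`hτ₂ : τ₂ = combF Lc M′ r′`, `hDbar : D̄ = σ • tgrad↾`, #19's shapes):
**`torus_uTop_eq_sum`** — for `D̄₁ D̄₂` tip-type ON THE TOP COMB with weights `u v` (anything off the comb), `secondVar (τ₂ D̄) (τ₂ D̄₁) (τ₂ D̄₂) =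
Σ_x [tipOf x = x]·(σ·v(b_x) − u(b_x)²)∕σ²`; hence `torus_uTop_eq_zero_of_sum_eq_zero` (the EXACT sufficient-and-necessary cancellation clause, weaker than
the termwise square law `σ·v = u²` of `CoarseFPExponential.torus_uTop_of_sq_on_comb`), and the POLARISED form **`torus_uTop_mixed_eq_sum`**
(`mixedVar (τ₂ D̄) (τ₂ D̄₁) (τ₂ D̄₁′) (τ₂ D̄₂) = Σ_x [tipOf x = x]·(σ·w(b_x) − u(b_x)·u′(b_x))∕σ²` — the defect KERNEL the polarised door ∕ `Dj` reads, by
`SecondVarPolarisation.secondVar_polarise`).  [folklore]; no `def`, no `def … : Prop`, nothing cited, 0 sorry.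
Nothing of the dictionary ∕ Bałaban's asserted; which branch leaf-02's order-2 tower row realises is NOT claimed here.

HONEST DEPENDENCY (page 1, mandatory): continuum YM on T⁴ ⇐ BetaPertH ∧ nine spine estimates (0/9 proved); BetaPertH ⇐ (D1) ∧ (D4) ∧ CAP+tail;
G-an2-4 gates asym, D1 and NE2/3/4.  HONEST FRAMING (cell contract, verbatim): «discharging `BetaPertH` makes Bałaban's UV stability UNCONDITIONAL —
a real constructive-QFT result; it is NOT the continuum limit and NOT the Clay problem.»  ABSOLUTE RULE (cell charter, verbatim): «No internally-minted
statement may enter as a cited fact. Every hypothesis is either kernel-proved in this package or a verbatim quotation of a PUBLISHED theorem with page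
reference. The manuscript(s) under audit are NOT citable for their own disputed steps — they are the thing under adjudication; programme-internal
(2001/route/tribunal) claims are never citable.»  0 estimates; 0∕4 row-D1 binders; NOT (T-ID), NOT SDF, NOT D1, NOT BetaPertH, NOT continuum, NOT Clay.
D1 formalisation swarm LEAF PROVER 06 (b2b-balaban-beta-d1-formalise-leaf-06 gen 22), 2026-08-22.  No existing file touched.
-/

noncomputable section

namespace Summit.QuantumFields.BalabanUV.Beta.FP.CoarseFPDefect

open Matrix Finset
open Literature.MathematicalPhysics.QuantumFieldTheory.Balaban1983to89
open Literature.MathematicalPhysics.QuantumFieldTheory.Balaban1983to89.Beta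
open B6Lemma24Torus (pbox)
open AffineAveraging (Site box toSite unitVec)
open OneStepResolventKernel (Fib)
open Summit.QuantumFields.BalabanUV.Beta.AxialDressingRooted (IsCombBondAt)
open Summit.QuantumFields.BalabanUV.Beta.D1BFx.LogDetSecondVariation (secondVar)
open Summit.QuantumFields.BalabanUV.Beta.FP.KernelPeriodisationFib (Idx)
open Summit.QuantumFields.BalabanUV.Beta.FP.TorusCombForest (rootOf depth stepOf axisOf baseOf tipOf base_tip_of_lt base_tip_of_not_lt)
open Summit.QuantumFields.BalabanUV.Beta.FP.TorusCombRows (Res combBondT combRowsT parentT baseOf_mem_pbox tgrad_combBondT depth_parentT)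
open Summit.QuantumFields.BalabanUV.Beta.FP.TorusGaugeCovariance (tgrad tdelta)
open Summit.QuantumFields.BalabanUV.Beta.FP.ForestTriangularJets (secondVar_forestTriangular_jets secondVar_unique)
open Summit.QuantumFields.BalabanUV.Beta.FP.CombSliceJetLetters (combRowsT_mul_forestTriangular combRowsT_mul_diag toSquareBlock_id_default)
open Summit.QuantumFields.BalabanUV.Beta.FP.TorusOneShotFPExponential (tipJet_combBondT tgrad_combLocal tipJet_combLocal stepOf_ne_site)
open Summit.QuantumFields.BalabanUV.Beta.FP.NestedStepLawTorusInstance (submatrix_field_mul submatrix_id_mul)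
open Summit.QuantumFields.BalabanUV.Beta.FP.TorusCompositeObjects (combF)
open Summit.QuantumFields.BalabanUV.Beta.FP.CoarseFPExponential (secondVar_smul combF_mul_congr_of_eqOn_comb)
open Summit.QuantumFields.BalabanUV.Beta.FP.SecondVarPolarisation (mixedVar secondVar_polarise)
open Summit.QuantumFields.BalabanUV.Beta.GAN24.FineReadoutCauchyFrame (toSite_mem_range)

variable {d : ℕ}

/-! ## §1 Comb-local jets: the second variation is the sum of its site terms -/

section Generic

variable {ρ : Site (d + 1)} {N : ℕ} {M : Fin (d + 1) → ℕ}

/-- [folklore] **SECOND VARIATION OF COMB-LOCAL JETS, IN CLOSED FORM**: if `D₀ D₁ D₂` are COMB-LOCAL (every row on the comb bond into `x` supported on the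
columns `x`, `stepOf x`) and `D₀` has non-zero diagonal comb entries, then
`secondVar (T·D₀↾Res) (T·D₁↾Res) (T·D₂↾Res) = Σ_x ( D₂(b_x, x)∕D₀(b_x, x) − (D₁(b_x, x)∕D₀(b_x, x))² )`, `T = combRowsT ρ N M`, `b_x = combBondT ρ N M x` —
forest-triangular ⇒ blockwise (`secondVar_forestTriangular_jets`, `site := id`), 1×1 blocks (`secondVar_unique`). -/
theorem secondVar_combRowsT_jets_eq_sum (hN : 0 < N) (hρ : ∀ i, 0 ≤ ρ i ∧ ρ i < N) (hM : ∀ i, N ∣ M i) (D₀ D₁ D₂ : Matrix (Idx M (Fib d)) ↥(pbox M) ℝ)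
    (h₀ : ∀ (x : Res ρ N M) (s : ↥(pbox M)), D₀ (combBondT ρ N M x) s ≠ 0 → (s : Site (d + 1)) = x.site ∨ (s : Site (d + 1)) = stepOf ρ N x.site)
    (h₁ : ∀ (x : Res ρ N M) (s : ↥(pbox M)), D₁ (combBondT ρ N M x) s ≠ 0 → (s : Site (d + 1)) = x.site ∨ (s : Site (d + 1)) = stepOf ρ N x.site)
    (h₂ : ∀ (x : Res ρ N M) (s : ↥(pbox M)), D₂ (combBondT ρ N M x) s ≠ 0 → (s : Site (d + 1)) = x.site ∨ (s : Site (d + 1)) = stepOf ρ N x.site)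
    (hd : ∀ x : Res ρ N M, D₀ (combBondT ρ N M x) x.1 ≠ 0) :
    secondVar (combRowsT ρ N M * D₀.submatrix id Subtype.val) (combRowsT ρ N M * D₁.submatrix id Subtype.val)
        (combRowsT ρ N M * D₂.submatrix id Subtype.val)
      = ∑ x : Res ρ N M, (D₂ (combBondT ρ N M x) x.1 / D₀ (combBondT ρ N M x) x.1
          - (D₁ (combBondT ρ N M x) x.1 / D₀ (combBondT ρ N M x) x.1) ^ 2) := by
  rw [secondVar_forestTriangular_jets _ _ _ id (fun y : Res ρ N M => depth ρ N y.site) (parentT ρ N M)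
    (fun x p h => depth_parentT hN hρ hM x p h) (combRowsT_mul_forestTriangular hN hρ hM D₀ h₀) (combRowsT_mul_forestTriangular hN hρ hM D₁ h₁)
    (combRowsT_mul_forestTriangular hN hρ hM D₂ h₂) (fun x _ => ?_)]
  · rw [Finset.image_id]
    refine Finset.sum_congr rfl fun x _ => ?_
    haveI : Unique {a : Res ρ N M // id a = x} := ⟨⟨⟨x, rfl⟩⟩, fun a => Subtype.ext a.2⟩
    rw [secondVar_unique _ _ _ (by rw [toSquareBlock_id_default, combRowsT_mul_diag]; exact hd x), toSquareBlock_id_default,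
      toSquareBlock_id_default, toSquareBlock_id_default, combRowsT_mul_diag, combRowsT_mul_diag, combRowsT_mul_diag]
  · -- the 1×1 block at `x` has determinant its entry
    haveI : Unique {a : Res ρ N M // id a = x} := ⟨⟨⟨x, rfl⟩⟩, fun a => Subtype.ext a.2⟩
    rw [Matrix.det_eq_elem_of_subsingleton _ default, toSquareBlock_id_default, combRowsT_mul_diag]
    exact hd x

/-- [folklore] **THE TIP-TYPE CASE**: at `D₀ := tgrad M` (diagonal comb entries `+1` on tip-oriented bonds, `−1` on base-oriented ones) and the tip-type jets
`D_{f₁}`, `D_{f₂}` (row `(y, a)` = `fₖ (y, a)·[y + e_a = s]`, ANY weights), the second variation along the comb is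
`Σ_x [tipOf x = x]·(f₂(b_x) − f₁(b_x)²)` with `b_x = (baseOf x, axisOf x)` the comb bond into `x`: base-oriented bonds contribute NOTHING (their tip jets
vanish on the diagonal), tip-oriented bonds their SQUARE-LAW DEFECT. -/
theorem secondVar_combRowsT_tipJets_eq_sum (hN : 0 < N) (hρ : ∀ i, 0 ≤ ρ i ∧ ρ i < N) (hM : ∀ i, N ∣ M i)
    (f₁ f₂ : ↥(pbox M) × Fin (d + 1) → ℝ) :
    secondVar (combRowsT ρ N M * (tgrad M).submatrix id Subtype.val)
      (combRowsT ρ N M * (Matrix.of fun (q : Idx M (Fib d)) (s : ↥(pbox M)) =>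
          Sum.elim (fun a : Fin (d + 1) => f₁ (q.1, a) * tdelta M ((q.1 : Site (d + 1)) + unitVec a) s) (fun _ => (0 : ℝ)) q.2).submatrix
        id Subtype.val)
      (combRowsT ρ N M * (Matrix.of fun (q : Idx M (Fib d)) (s : ↥(pbox M)) =>
          Sum.elim (fun a : Fin (d + 1) => f₂ (q.1, a) * tdelta M ((q.1 : Site (d + 1)) + unitVec a) s) (fun _ => (0 : ℝ)) q.2).submatrix
        id Subtype.val)
      = ∑ x : Res ρ N M, if tipOf ρ N x.site = x.site then
          f₂ (⟨baseOf ρ N x.site, baseOf_mem_pbox hN hρ hM x⟩, axisOf ρ N x.site)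
            - f₁ (⟨baseOf ρ N x.site, baseOf_mem_pbox hN hρ hM x⟩, axisOf ρ N x.site) ^ 2
        else 0 := by
  have hdiag : ∀ x : Res ρ N M, tgrad M (combBondT ρ N M x) x.1 ≠ 0 := fun x => by
    rw [tgrad_combBondT hN hρ hM x x.1]
    by_cases hlt : rootOf ρ N x.site (axisOf ρ N x.site) < x.site (axisOf ρ N x.site)
    · rw [(base_tip_of_lt hlt).1, (base_tip_of_lt hlt).2, if_pos rfl, if_neg (stepOf_ne_site hN hρ x)]; norm_num
    · rw [(base_tip_of_not_lt hlt).1, (base_tip_of_not_lt hlt).2, if_neg (stepOf_ne_site hN hρ x), if_pos rfl]; norm_num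
  rw [secondVar_combRowsT_jets_eq_sum hN hρ hM _ _ _ (tgrad_combLocal hN hρ hM) (tipJet_combLocal hN hρ hM f₁) (tipJet_combLocal hN hρ hM f₂) hdiag]
  refine Finset.sum_congr rfl fun x _ => ?_
  rw [tgrad_combBondT hN hρ hM x x.1, tipJet_combBondT hN hρ hM f₁ x x.1, tipJet_combBondT hN hρ hM f₂ x x.1]
  by_cases hlt : rootOf ρ N x.site (axisOf ρ N x.site) < x.site (axisOf ρ N x.site)
  · have htip : tipOf ρ N x.site = ((x.1 : ↥(pbox M)) : Site (d + 1)) := (base_tip_of_lt hlt).2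
    have hbase : ¬ baseOf ρ N x.site = ((x.1 : ↥(pbox M)) : Site (d + 1)) := by
      rw [(base_tip_of_lt hlt).1]; exact stepOf_ne_site hN hρ x
    rw [if_pos htip, if_neg hbase, if_pos htip]
    ring
  · have htip : ¬ tipOf ρ N x.site = ((x.1 : ↥(pbox M)) : Site (d + 1)) := by
      rw [(base_tip_of_not_lt hlt).2]; exact stepOf_ne_site hN hρ x
    have hbase : baseOf ρ N x.site = ((x.1 : ↥(pbox M)) : Site (d + 1)) := (base_tip_of_not_lt hlt).1
    rw [if_neg htip, if_pos hbase, if_neg htip]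
    ring

end Generic

/-! ## §2 At the torus call's coarse slice: the coarse Faddeev–Popov 2-jet of tip-type jets on the top comb, in closed form -/

section Torus

variable (M' : Fin (d + 1) → ℕ) {Lc : ℕ} [NeZero Lc] {r' : Fin (d + 1) → ℕ}

/-- [folklore] **THE COARSE CHART's FADDEEV–POPOV 2-JET IN CLOSED FORM** (#19's `hτ₂ hDbar` shapes; `D̄₁ D̄₂` ARBITRARY off the comb): if on every TOP-COMB
bond `a` the coarse jets are tip-type with weights `u a`, `v a` (`D̄ₖ a t = wₖ a·[tip a = t]`), then
`secondVar (τ₂ * D̄) (τ₂ * D̄₁) (τ₂ * D̄₂) = Σ_x [tipOf x = x]·(σ·v(b_x) − u(b_x)²)∕σ²` — the square law `σ·v = u²` per tip-oriented comb bond is the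
termwise-zero case (`CoarseFPExponential.torus_uTop_of_sq_on_comb`); otherwise the sum IS the coarse defect. -/
theorem torus_uTop_eq_sum (hr' : r' ∈ box (d + 1) Lc) (hM' : ∀ i, Lc ∣ M' i)
    {τ₂ : Matrix (Res (toSite r') Lc M') (↥(pbox M') × Fin (d + 1)) ℝ} (hτ₂ : τ₂ = combF Lc M' r') {σ : ℝ} (hσ : σ ≠ 0)
    {Dbar : Matrix (↥(pbox M') × Fin (d + 1)) (Res (toSite r') Lc M') ℝ}
    (hDbar : Dbar = σ • (tgrad M').submatrix (fun a : ↥(pbox M') × Fin (d + 1) => ((a.1, Sum.inl a.2) : Idx M' (Fib d)))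
      (fun t : Res (toSite r') Lc M' => (t.1 : ↥(pbox M'))))
    (Db₁ Db₂ : Matrix (↥(pbox M') × Fin (d + 1)) (Res (toSite r') Lc M') ℝ) (u v : ↥(pbox M') × Fin (d + 1) → ℝ)
    (hDb₁ : ∀ a : ↥(pbox M') × Fin (d + 1), IsCombBondAt (toSite r') Lc a.2 (a.1 : Site (d + 1)) →
      ∀ t : Res (toSite r') Lc M', Db₁ a t = u a * tdelta M' ((a.1 : Site (d + 1)) + unitVec a.2) t.1)
    (hDb₂ : ∀ a : ↥(pbox M') × Fin (d + 1), IsCombBondAt (toSite r') Lc a.2 (a.1 : Site (d + 1)) →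
      ∀ t : Res (toSite r') Lc M', Db₂ a t = v a * tdelta M' ((a.1 : Site (d + 1)) + unitVec a.2) t.1) :
    secondVar (τ₂ * Dbar) (τ₂ * Db₁) (τ₂ * Db₂)
      = ∑ x : Res (toSite r') Lc M', if tipOf (toSite r') Lc x.site = x.site then
          (σ * v (⟨baseOf (toSite r') Lc x.site, baseOf_mem_pbox (Nat.pos_of_ne_zero (NeZero.ne Lc)) (toSite_mem_range hr') hM' x⟩,
                axisOf (toSite r') Lc x.site)
            - u (⟨baseOf (toSite r') Lc x.site, baseOf_mem_pbox (Nat.pos_of_ne_zero (NeZero.ne Lc)) (toSite_mem_range hr') hM' x⟩,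
                axisOf (toSite r') Lc x.site) ^ 2) / σ ^ 2
        else 0 := by
  have hLc : 0 < Lc := Nat.pos_of_ne_zero (NeZero.ne Lc)
  -- on the comb, `D̄ₖ` ARE the tip jets `σ • D_{wₖ∕σ}`
  rw [combF_mul_congr_of_eqOn_comb M' hr' hM' hτ₂ Db₁
      (σ • Matrix.of fun (a : ↥(pbox M') × Fin (d + 1)) (t : Res (toSite r') Lc M') =>
        u a / σ * tdelta M' ((a.1 : Site (d + 1)) + unitVec a.2) t.1)
      (fun a ha t => by rw [hDb₁ a ha t, Matrix.smul_apply, Matrix.of_apply, smul_eq_mul]; field_simp),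
    combF_mul_congr_of_eqOn_comb M' hr' hM' hτ₂ Db₂
      (σ • Matrix.of fun (a : ↥(pbox M') × Fin (d + 1)) (t : Res (toSite r') Lc M') =>
        v a / σ * tdelta M' ((a.1 : Site (d + 1)) + unitVec a.2) t.1)
      (fun a ha t => by rw [hDb₂ a ha t, Matrix.smul_apply, Matrix.of_apply, smul_eq_mul]; field_simp)]
  subst hτ₂ hDbar
  rw [Matrix.mul_smul, Matrix.mul_smul, Matrix.mul_smul, secondVar_smul hσ]
  -- the three products as `combRowsT · (jet on the full torus index) ↾ Subtype.val`
  have e : ∀ w : ↥(pbox M') × Fin (d + 1) → ℝ, combF Lc M' r'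
        * (Matrix.of fun (a : ↥(pbox M') × Fin (d + 1)) (t : Res (toSite r') Lc M') =>
            w a / σ * tdelta M' ((a.1 : Site (d + 1)) + unitVec a.2) t.1)
      = combRowsT (toSite r') Lc M'
          * (Matrix.of fun (q : Idx M' (Fib d)) (s : ↥(pbox M')) =>
              Sum.elim (fun a : Fin (d + 1) => w (q.1, a) / σ * tdelta M' ((q.1 : Site (d + 1)) + unitVec a) s) (fun _ => (0 : ℝ)) q.2).submatrix
            id Subtype.val := fun w => by
    rw [combF, ← submatrix_id_mul, ← submatrix_field_mul M' _ _ (fun y κ c => rfl)]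
    congr 1
  rw [e u, e v, combF]
  erw [submatrix_field_mul M' _ _ (TorusGaugeCovariance.tgrad_inr M'), submatrix_id_mul]
  -- the column map `fun t => (t.1 : pbox M′)` of `hDbar` is `Subtype.val` up to unfolding `Res` (located g21): `erw`
  erw [secondVar_combRowsT_tipJets_eq_sum hLc (toSite_mem_range hr') hM' (fun b => u b / σ) (fun b => v b / σ)]
  refine Finset.sum_congr rfl fun x _ => ?_
  split_ifs
  · field_simp
  · rfl

/-- [folklore] **THE EXACT CANCELLATION CLAUSE**: under the same tip-type-on-the-comb hypotheses, `uTop` holds as soon as the square-law defects of the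
tip-oriented top-comb bonds SUM to zero — `Σ_x [tipOf x = x]·(σ·v(b_x) − u(b_x)²) = 0` (weaker than the termwise law of `torus_uTop_of_sq_on_comb`). -/
theorem torus_uTop_eq_zero_of_sum_eq_zero (hr' : r' ∈ box (d + 1) Lc) (hM' : ∀ i, Lc ∣ M' i)
    {τ₂ : Matrix (Res (toSite r') Lc M') (↥(pbox M') × Fin (d + 1)) ℝ} (hτ₂ : τ₂ = combF Lc M' r') {σ : ℝ} (hσ : σ ≠ 0)
    {Dbar : Matrix (↥(pbox M') × Fin (d + 1)) (Res (toSite r') Lc M') ℝ}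
    (hDbar : Dbar = σ • (tgrad M').submatrix (fun a : ↥(pbox M') × Fin (d + 1) => ((a.1, Sum.inl a.2) : Idx M' (Fib d)))
      (fun t : Res (toSite r') Lc M' => (t.1 : ↥(pbox M'))))
    (Db₁ Db₂ : Matrix (↥(pbox M') × Fin (d + 1)) (Res (toSite r') Lc M') ℝ) (u v : ↥(pbox M') × Fin (d + 1) → ℝ)
    (hDb₁ : ∀ a : ↥(pbox M') × Fin (d + 1), IsCombBondAt (toSite r') Lc a.2 (a.1 : Site (d + 1)) →
      ∀ t : Res (toSite r') Lc M', Db₁ a t = u a * tdelta M' ((a.1 : Site (d + 1)) + unitVec a.2) t.1)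
    (hDb₂ : ∀ a : ↥(pbox M') × Fin (d + 1), IsCombBondAt (toSite r') Lc a.2 (a.1 : Site (d + 1)) →
      ∀ t : Res (toSite r') Lc M', Db₂ a t = v a * tdelta M' ((a.1 : Site (d + 1)) + unitVec a.2) t.1)
    (hsum : ∑ x : Res (toSite r') Lc M', (if tipOf (toSite r') Lc x.site = x.site then
          (σ * v (⟨baseOf (toSite r') Lc x.site, baseOf_mem_pbox (Nat.pos_of_ne_zero (NeZero.ne Lc)) (toSite_mem_range hr') hM' x⟩,
                axisOf (toSite r') Lc x.site)
            - u (⟨baseOf (toSite r') Lc x.site, baseOf_mem_pbox (Nat.pos_of_ne_zero (NeZero.ne Lc)) (toSite_mem_range hr') hM' x⟩,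
                axisOf (toSite r') Lc x.site) ^ 2)
        else 0) = 0) :
    secondVar (τ₂ * Dbar) (τ₂ * Db₁) (τ₂ * Db₂) = 0 := by
  rw [torus_uTop_eq_sum M' hr' hM' hτ₂ hσ hDbar Db₁ Db₂ u v hDb₁ hDb₂]
  have : ∑ x : Res (toSite r') Lc M', (if tipOf (toSite r') Lc x.site = x.site then
          (σ * v (⟨baseOf (toSite r') Lc x.site, baseOf_mem_pbox (Nat.pos_of_ne_zero (NeZero.ne Lc)) (toSite_mem_range hr') hM' x⟩,
                axisOf (toSite r') Lc x.site)
            - u (⟨baseOf (toSite r') Lc x.site, baseOf_mem_pbox (Nat.pos_of_ne_zero (NeZero.ne Lc)) (toSite_mem_range hr') hM' x⟩,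
                axisOf (toSite r') Lc x.site) ^ 2) / σ ^ 2
        else 0)
      = (∑ x : Res (toSite r') Lc M', (if tipOf (toSite r') Lc x.site = x.site then
          (σ * v (⟨baseOf (toSite r') Lc x.site, baseOf_mem_pbox (Nat.pos_of_ne_zero (NeZero.ne Lc)) (toSite_mem_range hr') hM' x⟩,
                axisOf (toSite r') Lc x.site)
            - u (⟨baseOf (toSite r') Lc x.site, baseOf_mem_pbox (Nat.pos_of_ne_zero (NeZero.ne Lc)) (toSite_mem_range hr') hM' x⟩,
                axisOf (toSite r') Lc x.site) ^ 2)
        else 0)) / σ ^ 2 := by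
    rw [Finset.sum_div]
    refine Finset.sum_congr rfl fun x _ => ?_
    split_ifs
    · rfl
    · rw [zero_div]
  rw [this, hsum, zero_div]

/-- [folklore] **THE COARSE DEFECT KERNEL — THE POLARISED CLOSED FORM** (what R-FP-56 (b)'s `Dj` needs once the door is polarised, OWNER #20
`SecondVarKernelLaw`): for two first coarse jets `D̄₁ D̄₁′` (weights `u u′` on the top comb) and a mixed second jet `D̄₂` (weight `w`), all tip-type ON THE
TOP COMB (anything off it), `mixedVar (τ₂ D̄) (τ₂ D̄₁) (τ₂ D̄₁′) (τ₂ D̄₂) = Σ_x [tipOf x = x]·(σ·w(b_x) − u(b_x)·u′(b_x))∕σ²` — by `secondVar_polarise`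
from `torus_uTop_eq_sum` along `u`, `u′`, `u + u′` (tip jets are linear in their weights). -/
theorem torus_uTop_mixed_eq_sum (hr' : r' ∈ box (d + 1) Lc) (hM' : ∀ i, Lc ∣ M' i)
    {τ₂ : Matrix (Res (toSite r') Lc M') (↥(pbox M') × Fin (d + 1)) ℝ} (hτ₂ : τ₂ = combF Lc M' r') {σ : ℝ} (hσ : σ ≠ 0)
    {Dbar : Matrix (↥(pbox M') × Fin (d + 1)) (Res (toSite r') Lc M') ℝ}
    (hDbar : Dbar = σ • (tgrad M').submatrix (fun a : ↥(pbox M') × Fin (d + 1) => ((a.1, Sum.inl a.2) : Idx M' (Fib d)))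
      (fun t : Res (toSite r') Lc M' => (t.1 : ↥(pbox M'))))
    (Db₁ Db₁' Db₂ : Matrix (↥(pbox M') × Fin (d + 1)) (Res (toSite r') Lc M') ℝ) (u u' w : ↥(pbox M') × Fin (d + 1) → ℝ)
    (hDb₁ : ∀ a : ↥(pbox M') × Fin (d + 1), IsCombBondAt (toSite r') Lc a.2 (a.1 : Site (d + 1)) →
      ∀ t : Res (toSite r') Lc M', Db₁ a t = u a * tdelta M' ((a.1 : Site (d + 1)) + unitVec a.2) t.1)
    (hDb₁' : ∀ a : ↥(pbox M') × Fin (d + 1), IsCombBondAt (toSite r') Lc a.2 (a.1 : Site (d + 1)) →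
      ∀ t : Res (toSite r') Lc M', Db₁' a t = u' a * tdelta M' ((a.1 : Site (d + 1)) + unitVec a.2) t.1)
    (hDb₂ : ∀ a : ↥(pbox M') × Fin (d + 1), IsCombBondAt (toSite r') Lc a.2 (a.1 : Site (d + 1)) →
      ∀ t : Res (toSite r') Lc M', Db₂ a t = w a * tdelta M' ((a.1 : Site (d + 1)) + unitVec a.2) t.1) :
    mixedVar (τ₂ * Dbar) (τ₂ * Db₁) (τ₂ * Db₁') (τ₂ * Db₂)
      = ∑ x : Res (toSite r') Lc M', if tipOf (toSite r') Lc x.site = x.site then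
          (σ * w (⟨baseOf (toSite r') Lc x.site, baseOf_mem_pbox (Nat.pos_of_ne_zero (NeZero.ne Lc)) (toSite_mem_range hr') hM' x⟩,
                axisOf (toSite r') Lc x.site)
            - u (⟨baseOf (toSite r') Lc x.site, baseOf_mem_pbox (Nat.pos_of_ne_zero (NeZero.ne Lc)) (toSite_mem_range hr') hM' x⟩,
                axisOf (toSite r') Lc x.site)
              * u' (⟨baseOf (toSite r') Lc x.site, baseOf_mem_pbox (Nat.pos_of_ne_zero (NeZero.ne Lc)) (toSite_mem_range hr') hM' x⟩,
                axisOf (toSite r') Lc x.site)) / σ ^ 2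
        else 0 := by
  -- the three `secondVar`s of the polarisation identity, each in closed form
  have S₁ := torus_uTop_eq_sum M' hr' hM' hτ₂ hσ hDbar (Db₁ + Db₁') (0 + (2 : ℝ) • Db₂ + 0) (fun a => u a + u' a) (fun a => 2 * w a)
    (fun a ha t => by rw [Matrix.add_apply, hDb₁ a ha t, hDb₁' a ha t]; ring)
    (fun a ha t => by rw [add_zero, zero_add, Matrix.smul_apply, hDb₂ a ha t, smul_eq_mul]; ring)
  have S₂ := torus_uTop_eq_sum M' hr' hM' hτ₂ hσ hDbar Db₁ 0 u (fun _ => 0) hDb₁ (fun a _ t => by rw [Matrix.zero_apply, zero_mul])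
  have S₃ := torus_uTop_eq_sum M' hr' hM' hτ₂ hσ hDbar Db₁' 0 u' (fun _ => 0) hDb₁' (fun a _ t => by rw [Matrix.zero_apply, zero_mul])
  have key := secondVar_polarise (τ₂ * Dbar) (τ₂ * Db₁) (τ₂ * Db₁')
    (τ₂ * (0 : Matrix (↥(pbox M') × Fin (d + 1)) (Res (toSite r') Lc M') ℝ))
    (τ₂ * (0 : Matrix (↥(pbox M') × Fin (d + 1)) (Res (toSite r') Lc M') ℝ)) (τ₂ * Db₂)
  have e₁ : τ₂ * Db₁ + τ₂ * Db₁' = τ₂ * (Db₁ + Db₁') := (Matrix.mul_add τ₂ Db₁ Db₁').symm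
  have e₂ : τ₂ * (0 : Matrix (↥(pbox M') × Fin (d + 1)) (Res (toSite r') Lc M') ℝ) + (2 : ℝ) • (τ₂ * Db₂)
      + τ₂ * (0 : Matrix (↥(pbox M') × Fin (d + 1)) (Res (toSite r') Lc M') ℝ)
      = τ₂ * (0 + (2 : ℝ) • Db₂ + 0) := by
    rw [Matrix.mul_add, Matrix.mul_add, Matrix.mul_smul]
  rw [e₁, e₂, S₁, S₂, S₃, ← Finset.sum_sub_distrib, ← Finset.sum_sub_distrib] at key
  have h2 : (2 : ℝ) * mixedVar (τ₂ * Dbar) (τ₂ * Db₁) (τ₂ * Db₁') (τ₂ * Db₂)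
      = 2 * ∑ x : Res (toSite r') Lc M', (if tipOf (toSite r') Lc x.site = x.site then
          (σ * w (⟨baseOf (toSite r') Lc x.site, baseOf_mem_pbox (Nat.pos_of_ne_zero (NeZero.ne Lc)) (toSite_mem_range hr') hM' x⟩,
                axisOf (toSite r') Lc x.site)
            - u (⟨baseOf (toSite r') Lc x.site, baseOf_mem_pbox (Nat.pos_of_ne_zero (NeZero.ne Lc)) (toSite_mem_range hr') hM' x⟩,
                axisOf (toSite r') Lc x.site)
              * u' (⟨baseOf (toSite r') Lc x.site, baseOf_mem_pbox (Nat.pos_of_ne_zero (NeZero.ne Lc)) (toSite_mem_range hr') hM' x⟩,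
                axisOf (toSite r') Lc x.site)) / σ ^ 2
        else 0) := by
    rw [← key, Finset.mul_sum]
    refine Finset.sum_congr rfl fun x _ => ?_
    split_ifs
    · field_simp
      ring
    · simp
  exact mul_left_cancel₀ two_ne_zero h2

end Torus

end Summit.QuantumFields.BalabanUV.Beta.FP.CoarseFPDefect

end
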